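import Literature.MathematicalPhysics.QuantumFieldTheory.ConformalBootstrap3D.PointFunctionalQuadCell
import HarnessLib

/-!
# Node-level head rule for the point functional (real side of the Taylor-model kernel)

For a spin-`ℓ` row cell `[a, b)` and an `s`-piece `[σ, σ + δ]` the head sum
`Σ_{q ∈ headSet ℓ n_F} A_q(Δ) Φ(crossF_s 𝓜_{Δ+n, j})` of the twisted `z`-series is rewritten
NODE BY NODE (`head_sum_eq_nodes`) as `Σ_k w_k (v_k^s u_k^{Δ/2} H_k(Δ) − u_k^s v_k^{Δ/2} H̃_k(Δ))`,
`u = z z̄`, `v = (1−z)(1−z̄)`, with the NON-NEGATIVE node sums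
`H_k(Δ) = Σ_q A_q(Δ) u_k^{(n−j)/2} 𝒫_j(z_k, z̄_k)` (`nodeHead`). Writing `s = σ + θδ`, the single
factor `(base^δ)^θ` is sandwiched by the quadratics `qlo ≤ r^θ ≤ qhi` of `PointFunctionalQuad`,
selected by the sign of the amplitude (`qselCoeff`); since it multiplies a non-negative factor no
node-ratio condition is needed. The result is a θ-quadratic minorant
`G₀(Δ) + θ G₁(Δ) + θ² G₂(Δ)` of the head sum (`headG`, `headG_quad_le`) whose coefficients are
smooth in `Δ` — the functions a Taylor-model kernel encloses cell by cell.
`blockPositive_pointFunctional_of_headG_Ico` and `cell_of_headG_pieces` turn non-negativity of the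
minorant plus the twist-domain tail into block positivity on `Q × [a, b)`, in the shape consumed by
`boxExcluded_of_pointCells`.
-/

namespace Literature.MathematicalPhysics.QuantumFieldTheory.ConformalBootstrap3D

open Finset Set

/-! ### Node head sums -/

/-- The node head sum `H(x, y, Δ) = Σ_{q ∈ headSet ℓ n_F} A_q(Δ) (xy)^{(n-j)/2} 𝒫_j(x, y)`.
[cite: HogervorstRychkov2013, §3 eq. (3.6)] -/
noncomputable def nodeHead (ℓ nF : ℕ) (x y Δ : ℝ) : ℝ :=
  ∑ q ∈ headSet ℓ nF, hrCoeff Δ ℓ q.1 q.2 * ((x * y) ^ (((q.1 : ℝ) - q.2) / 2) * zLegendre q.2 x y)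

/-- `H(x, y, Δ) ≥ 0` above the unitarity bound for `x, y ≥ 0`. [cite: HogervorstRychkov2013, §3 eq. (3.9)] -/
theorem nodeHead_nonneg {ℓ : ℕ} (nF : ℕ) {x y Δ : ℝ} (hΔ : unitarityBound3D ℓ < Δ) (hx : 0 ≤ x)
    (hy : 0 ≤ y) : 0 ≤ nodeHead ℓ nF x y Δ :=
  Finset.sum_nonneg fun q _ => mul_nonneg (hrCoeff_nonneg hΔ q.1 q.2)
    (mul_nonneg (Real.rpow_nonneg (mul_nonneg hx hy) _) (zLegendre_nonneg _ hx hy))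

/-- `𝓜_{Δ+n, j}(x, y) = (xy)^{Δ/2} · (xy)^{(n-j)/2} 𝒫_j(x, y)`. [folklore] -/
theorem zMono_natAdd_split (Δ : ℝ) (n j : ℕ) {x y : ℝ} (hx : 0 < x) (hy : 0 < y) :
    zMono (Δ + n) j x y = (x * y) ^ (Δ / 2) * ((x * y) ^ (((n : ℝ) - j) / 2) * zLegendre j x y) := by
  simp only [zMono]
  have hxy : 0 < x * y := mul_pos hx hy
  rw [show (Δ + (n : ℝ) - (j : ℝ)) / 2 = Δ / 2 + ((n : ℝ) - j) / 2 by ring, Real.rpow_add hxy]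
  ring

/-- **The head sum node by node**:
`Σ_q A_q Φ(crossF_s 𝓜_{Δ+n,j}) = Σ_k w_k (v_k^s u_k^{Δ/2} H_k(Δ) − u_k^s v_k^{Δ/2} H̃_k(Δ))`.
[cite: HogervorstRychkov2013, §3 eq. (3.6)] -/
theorem head_sum_eq_nodes {N : ℕ} (w z zb : Fin N → ℝ)
    (hz : ∀ k, z k ∈ Ioo (0 : ℝ) 1) (hzb : ∀ k, zb k ∈ Ioo (0 : ℝ) 1) (ℓ nF : ℕ) (s Δ : ℝ) :
    ∑ q ∈ headSet ℓ nF, hrCoeff Δ ℓ q.1 q.2 *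
        pointFunctional w z zb (crossF s (-1) (zMono (Δ + (q.1 : ℝ)) q.2)) =
      ∑ k, w k * (((1 - z k) * (1 - zb k)) ^ s * ((z k * zb k) ^ (Δ / 2) * nodeHead ℓ nF (z k) (zb k) Δ)
        - (z k * zb k) ^ s * (((1 - z k) * (1 - zb k)) ^ (Δ / 2) *
          nodeHead ℓ nF (1 - z k) (1 - zb k) Δ)) := by
  have hR : ∀ k : Fin N,
      w k * (((1 - z k) * (1 - zb k)) ^ s * ((z k * zb k) ^ (Δ / 2) * nodeHead ℓ nF (z k) (zb k) Δ)
        - (z k * zb k) ^ s * (((1 - z k) * (1 - zb k)) ^ (Δ / 2) *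
          nodeHead ℓ nF (1 - z k) (1 - zb k) Δ)) =
      ∑ q ∈ headSet ℓ nF, w k * (((1 - z k) * (1 - zb k)) ^ s * ((z k * zb k) ^ (Δ / 2) *
          (hrCoeff Δ ℓ q.1 q.2 * ((z k * zb k) ^ (((q.1 : ℝ) - q.2) / 2) * zLegendre q.2 (z k) (zb k))))
        - (z k * zb k) ^ s * (((1 - z k) * (1 - zb k)) ^ (Δ / 2) *
          (hrCoeff Δ ℓ q.1 q.2 * (((1 - z k) * (1 - zb k)) ^ (((q.1 : ℝ) - q.2) / 2) *
            zLegendre q.2 (1 - z k) (1 - zb k))))) := by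
    intro k
    simp only [nodeHead, Finset.mul_sum, ← Finset.sum_sub_distrib]
  have hL : ∀ q ∈ headSet ℓ nF, hrCoeff Δ ℓ q.1 q.2 *
        pointFunctional w z zb (crossF s (-1) (zMono (Δ + (q.1 : ℝ)) q.2)) =
      ∑ k, w k * (((1 - z k) * (1 - zb k)) ^ s * ((z k * zb k) ^ (Δ / 2) *
          (hrCoeff Δ ℓ q.1 q.2 * ((z k * zb k) ^ (((q.1 : ℝ) - q.2) / 2) * zLegendre q.2 (z k) (zb k))))
        - (z k * zb k) ^ s * (((1 - z k) * (1 - zb k)) ^ (Δ / 2) *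
          (hrCoeff Δ ℓ q.1 q.2 * (((1 - z k) * (1 - zb k)) ^ (((q.1 : ℝ) - q.2) / 2) *
            zLegendre q.2 (1 - z k) (1 - zb k))))) := by
    intro q _
    rw [pointFunctional_apply, Finset.mul_sum]
    refine Finset.sum_congr rfl (fun k _ => ?_)
    have hzk := hz k; have hzbk := hzb k
    simp only [crossF]
    rw [zMono_natAdd_split Δ q.1 q.2 hzk.1 hzbk.1,
      zMono_natAdd_split Δ q.1 q.2 (by linarith [hzk.2]) (by linarith [hzbk.2])]
    ring
  rw [Finset.sum_congr rfl hL, Finset.sum_comm]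
  exact Finset.sum_congr rfl (fun k _ => (hR k).symm)

/-! ### The sign-selected sandwich quadratic -/

/-- Coefficient `m` of the selected sandwich quadratic: `qlo` for amplitude `c ≥ 0`, `qhi` for `c < 0`.
[folklore] -/
noncomputable def qselCoeff (c r : ℝ) (m : ℕ) : ℝ := if 0 ≤ c then qloCoeff r m else qhiCoeff r m

/-- `c · qsel(θ) · F ≤ c · r^θ · F` for `F ≥ 0`, `r ∈ (0, 1]`, `θ ∈ [0, 1]`. [folklore] -/
theorem qsel_mul_le {c r θ F : ℝ} (hr : 0 < r) (hr1 : r ≤ 1) (hθ0 : 0 ≤ θ) (hθ1 : θ ≤ 1)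
    (hF : 0 ≤ F) :
    c * (qselCoeff c r 0 + qselCoeff c r 1 * θ + qselCoeff c r 2 * θ ^ 2) * F ≤ c * r ^ θ * F := by
  unfold qselCoeff
  split_ifs with hc
  · have hq : qloCoeff r 0 + qloCoeff r 1 * θ + qloCoeff r 2 * θ ^ 2 = qlo r θ := by
      simp only [qloCoeff, qlo]; ring
    rw [hq]
    have h1 := qlo_le_rpow hr hr1 hθ0 hθ1
    have hcF : 0 ≤ c * F := mul_nonneg hc hF
    nlinarith
  · have hq : qhiCoeff r 0 + qhiCoeff r 1 * θ + qhiCoeff r 2 * θ ^ 2 = qhi r θ := by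
      simp only [qhiCoeff, qhi]; ring
    rw [hq]
    have h1 := rpow_le_qhi hr hr1 hθ0 hθ1
    have hcF : c * F ≤ 0 := mul_nonpos_of_nonpos_of_nonneg (le_of_lt (lt_of_not_ge hc)) hF
    nlinarith

/-! ### The node-level quadratic minorant -/

/-- Node `k`'s contribution to the `θ^m`-coefficient of the minorant on the piece `[σ, σ + δ]`:
`w_k v_k^σ · q_m(v_k^δ) · u_k^{Δ/2} H_k(Δ) − w_k u_k^σ · q̃_m(u_k^δ) · v_k^{Δ/2} H̃_k(Δ)` with the
sign-selected sandwich coefficients. [cite: HogervorstRychkov2013, §3 eq. (3.6)] -/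
noncomputable def nodeG {N : ℕ} (w z zb : Fin N → ℝ) (ℓ nF : ℕ) (σ δ : ℝ) (k : Fin N) (m : ℕ)
    (Δ : ℝ) : ℝ :=
  (w k * ((1 - z k) * (1 - zb k)) ^ σ) *
      qselCoeff (w k * ((1 - z k) * (1 - zb k)) ^ σ) (((1 - z k) * (1 - zb k)) ^ δ) m *
      ((z k * zb k) ^ (Δ / 2) * nodeHead ℓ nF (z k) (zb k) Δ)
    + (-(w k * (z k * zb k) ^ σ)) *
      qselCoeff (-(w k * (z k * zb k) ^ σ)) ((z k * zb k) ^ δ) m *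
      (((1 - z k) * (1 - zb k)) ^ (Δ / 2) * nodeHead ℓ nF (1 - z k) (1 - zb k) Δ)

/-- The `θ^m`-coefficient `G_m(Δ) = Σ_k nodeG_k,m(Δ)` of the minorant. [cite: HogervorstRychkov2013, §3 eq. (3.6)] -/
noncomputable def headG {N : ℕ} (w z zb : Fin N → ℝ) (ℓ nF : ℕ) (σ δ : ℝ) (m : ℕ) (Δ : ℝ) : ℝ :=
  ∑ k, nodeG w z zb ℓ nF σ δ k m Δ

/-- per node: the quadratic is below the node term at `s = σ + θδ`. [cite: HogervorstRychkov2013, §3 eq. (3.6)] -/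
theorem nodeG_quad_le {N : ℕ} (w z zb : Fin N → ℝ)
    (hz : ∀ k, z k ∈ Ioo (0 : ℝ) 1) (hzb : ∀ k, zb k ∈ Ioo (0 : ℝ) 1) (ℓ nF : ℕ) {σ δ θ Δ : ℝ}
    (hδ : 0 ≤ δ) (hθ : θ ∈ Icc (0 : ℝ) 1) (hΔ : unitarityBound3D ℓ < Δ) (k : Fin N) :
    nodeG w z zb ℓ nF σ δ k 0 Δ + θ * nodeG w z zb ℓ nF σ δ k 1 Δ + θ ^ 2 * nodeG w z zb ℓ nF σ δ k 2 Δ ≤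
      w k * (((1 - z k) * (1 - zb k)) ^ (σ + θ * δ) * ((z k * zb k) ^ (Δ / 2) * nodeHead ℓ nF (z k) (zb k) Δ)
        - (z k * zb k) ^ (σ + θ * δ) * (((1 - z k) * (1 - zb k)) ^ (Δ / 2) *
          nodeHead ℓ nF (1 - z k) (1 - zb k) Δ)) := by
  have hzk := hz k; have hzbk := hzb k
  have hv : 0 < (1 - z k) * (1 - zb k) := mul_pos (by linarith [hzk.2]) (by linarith [hzbk.2])
  have hu : 0 < z k * zb k := mul_pos hzk.1 hzbk.1
  have hv1 : (1 - z k) * (1 - zb k) ≤ 1 := by nlinarith [hzk.1, hzk.2, hzbk.1, hzbk.2]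
  have hu1 : z k * zb k ≤ 1 := by nlinarith [hzk.1, hzk.2, hzbk.1, hzbk.2]
  have hrv : 0 < ((1 - z k) * (1 - zb k)) ^ δ := Real.rpow_pos_of_pos hv δ
  have hru : 0 < (z k * zb k) ^ δ := Real.rpow_pos_of_pos hu δ
  have hrv1 : ((1 - z k) * (1 - zb k)) ^ δ ≤ 1 := Real.rpow_le_one hv.le hv1 hδ
  have hru1 : (z k * zb k) ^ δ ≤ 1 := Real.rpow_le_one hu.le hu1 hδ
  have hFP : 0 ≤ (z k * zb k) ^ (Δ / 2) * nodeHead ℓ nF (z k) (zb k) Δ :=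
    mul_nonneg (Real.rpow_nonneg hu.le _) (nodeHead_nonneg nF hΔ hzk.1.le hzbk.1.le)
  have hFM : 0 ≤ ((1 - z k) * (1 - zb k)) ^ (Δ / 2) * nodeHead ℓ nF (1 - z k) (1 - zb k) Δ :=
    mul_nonneg (Real.rpow_nonneg hv.le _)
      (nodeHead_nonneg nF hΔ (by linarith [hzk.2]) (by linarith [hzbk.2]))
  have h1 := qsel_mul_le (c := w k * ((1 - z k) * (1 - zb k)) ^ σ) hrv hrv1 hθ.1 hθ.2 hFP
  have h2 := qsel_mul_le (c := -(w k * (z k * zb k) ^ σ)) hru hru1 hθ.1 hθ.2 hFM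
  have hvs : ((1 - z k) * (1 - zb k)) ^ (σ + θ * δ) =
      ((1 - z k) * (1 - zb k)) ^ σ * (((1 - z k) * (1 - zb k)) ^ δ) ^ θ := by
    rw [Real.rpow_add hv, ← Real.rpow_mul hv.le, mul_comm δ θ]
  have hus : (z k * zb k) ^ (σ + θ * δ) = (z k * zb k) ^ σ * ((z k * zb k) ^ δ) ^ θ := by
    rw [Real.rpow_add hu, ← Real.rpow_mul hu.le, mul_comm δ θ]
  rw [hvs, hus]
  have e : nodeG w z zb ℓ nF σ δ k 0 Δ + θ * nodeG w z zb ℓ nF σ δ k 1 Δ +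
      θ ^ 2 * nodeG w z zb ℓ nF σ δ k 2 Δ =
    (w k * ((1 - z k) * (1 - zb k)) ^ σ) *
        (qselCoeff (w k * ((1 - z k) * (1 - zb k)) ^ σ) (((1 - z k) * (1 - zb k)) ^ δ) 0
          + qselCoeff (w k * ((1 - z k) * (1 - zb k)) ^ σ) (((1 - z k) * (1 - zb k)) ^ δ) 1 * θ
          + qselCoeff (w k * ((1 - z k) * (1 - zb k)) ^ σ) (((1 - z k) * (1 - zb k)) ^ δ) 2 * θ ^ 2) *
        ((z k * zb k) ^ (Δ / 2) * nodeHead ℓ nF (z k) (zb k) Δ)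
      + (-(w k * (z k * zb k) ^ σ)) *
        (qselCoeff (-(w k * (z k * zb k) ^ σ)) ((z k * zb k) ^ δ) 0
          + qselCoeff (-(w k * (z k * zb k) ^ σ)) ((z k * zb k) ^ δ) 1 * θ
          + qselCoeff (-(w k * (z k * zb k) ^ σ)) ((z k * zb k) ^ δ) 2 * θ ^ 2) *
        (((1 - z k) * (1 - zb k)) ^ (Δ / 2) * nodeHead ℓ nF (1 - z k) (1 - zb k) Δ) := by
    simp only [nodeG]; ring
  rw [e]
  calc _ ≤ (w k * ((1 - z k) * (1 - zb k)) ^ σ) * (((1 - z k) * (1 - zb k)) ^ δ) ^ θ *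
          ((z k * zb k) ^ (Δ / 2) * nodeHead ℓ nF (z k) (zb k) Δ)
        + (-(w k * (z k * zb k) ^ σ)) * ((z k * zb k) ^ δ) ^ θ *
          (((1 - z k) * (1 - zb k)) ^ (Δ / 2) * nodeHead ℓ nF (1 - z k) (1 - zb k) Δ) :=
        add_le_add h1 h2
    _ = _ := by ring

/-- **The node-level quadratic minorant**: for `s = σ + θδ`, `θ ∈ [0, 1]`, `δ ≥ 0` and `Δ` above the
unitarity bound, `G₀(Δ) + θ G₁(Δ) + θ² G₂(Δ) ≤ Σ_{q ∈ headSet} A_q(Δ) Φ(crossF_s 𝓜_{Δ+n, j})`.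
[cite: HogervorstRychkov2013, §3 eq. (3.6)] -/
theorem headG_quad_le {N : ℕ} (w z zb : Fin N → ℝ)
    (hz : ∀ k, z k ∈ Ioo (0 : ℝ) 1) (hzb : ∀ k, zb k ∈ Ioo (0 : ℝ) 1) (ℓ nF : ℕ) {σ δ θ Δ : ℝ}
    (hδ : 0 ≤ δ) (hθ : θ ∈ Icc (0 : ℝ) 1) (hΔ : unitarityBound3D ℓ < Δ) :
    headG w z zb ℓ nF σ δ 0 Δ + θ * headG w z zb ℓ nF σ δ 1 Δ + θ ^ 2 * headG w z zb ℓ nF σ δ 2 Δ ≤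
      ∑ q ∈ headSet ℓ nF, hrCoeff Δ ℓ q.1 q.2 *
        pointFunctional w z zb (crossF (σ + θ * δ) (-1) (zMono (Δ + (q.1 : ℝ)) q.2)) := by
  rw [head_sum_eq_nodes w z zb hz hzb]
  have e : headG w z zb ℓ nF σ δ 0 Δ + θ * headG w z zb ℓ nF σ δ 1 Δ +
      θ ^ 2 * headG w z zb ℓ nF σ δ 2 Δ =
    ∑ k, (nodeG w z zb ℓ nF σ δ k 0 Δ + θ * nodeG w z zb ℓ nF σ δ k 1 Δ +
      θ ^ 2 * nodeG w z zb ℓ nF σ δ k 2 Δ) := by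
    simp only [headG, Finset.mul_sum, ← Finset.sum_add_distrib]
  rw [e]
  exact Finset.sum_le_sum (fun k _ => nodeG_quad_le w z zb hz hzb ℓ nF hδ hθ hΔ k)

/-! ### Block positivity on a cell from the minorant -/

/-- **Node-level head cell rule, half-open cell, one `s`-piece.** Nodes in the open square,
`unitarityBound3D ℓ ≤ a`, `δ ≥ 0`, `s ∈ [σ, σ + δ]`; if the minorant is non-negative at every
`(θ, Δ) ∈ [0,1] × [a, b]` with `Δ` above the unitarity bound, and the tail terms at `s` are
non-negative, then `φ_s` is block-positive at every `Δ ∈ [a, b)` (irregular points by continuity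
from the right). [cite: HogervorstRychkov2013, §3 eq. (3.9)] -/
theorem blockPositive_pointFunctional_of_headG_Ico {N : ℕ} (w z zb : Fin N → ℝ)
    (hz : ∀ k, z k ∈ Ioo (0 : ℝ) 1) (hzb : ∀ k, zb k ∈ Ioo (0 : ℝ) 1) {ℓ : ℕ} (nF : ℕ)
    {a b σ δ s : ℝ} (hδ : 0 ≤ δ) (hbd : unitarityBound3D ℓ ≤ a) (hs : s ∈ Icc σ (σ + δ))
    (hpos : ∀ Δ ∈ Icc a b, unitarityBound3D ℓ < Δ → ∀ θ ∈ Icc (0 : ℝ) 1,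
      0 ≤ headG w z zb ℓ nF σ δ 0 Δ + θ * headG w z zb ℓ nF σ δ 1 Δ +
        θ ^ 2 * headG w z zb ℓ nF σ δ 2 Δ)
    (htail : ∀ q : ℕ × ℕ, q ∉ headSet ℓ nF → InDescendantRange ℓ q.1 q.2 →
      ∀ E ∈ Icc (a + q.1) (b + q.1), 0 ≤ pointFunctional w z zb (crossF s (-1) (zMono E q.2))) :
    ∀ Δ ∈ Ico a b, BlockPositive (pointFunctional w z zb) s Δ ℓ := by
  have hreg : ∀ Δ' ∈ Icc a b, IsRegularPoint3D Δ' ℓ →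
      BlockPositive (pointFunctional w z zb) s Δ' ℓ := by
    intro Δ' hΔ' hr
    have hlt : unitarityBound3D ℓ < Δ' := lt_of_le_of_ne (hbd.trans hΔ'.1) (Ne.symm hr.1)
    obtain ⟨θ, hθ, hsθ⟩ := exists_boxCoord hs
    have hs' : σ + θ * δ = s := by rw [hsθ]; ring
    refine blockPositive_pointFunctional_of_termwise w z zb hz hzb hlt hr.2 (headSet ℓ nF) ?_ ?_
    · have hsum := (hpos Δ' hΔ' hlt θ hθ).trans (headG_quad_le w z zb hz hzb ℓ nF hδ hθ hlt)
      rw [hs'] at hsum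
      have hrw : ∑ q ∈ headSet ℓ nF, hrCoeff Δ' ℓ q.1 q.2 / legendreLam ℓ *
          pointFunctional w z zb (crossF s (-1) (zMono (Δ' + (q.1 : ℝ)) q.2)) =
          (1 / legendreLam ℓ) * ∑ q ∈ headSet ℓ nF, hrCoeff Δ' ℓ q.1 q.2 *
            pointFunctional w z zb (crossF s (-1) (zMono (Δ' + (q.1 : ℝ)) q.2)) := by
        rw [Finset.mul_sum]; exact Finset.sum_congr rfl (fun q _ => by ring)
      rw [hrw]
      have hlam : 0 < legendreLam ℓ := legendreLam_pos ℓ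
      exact mul_nonneg (by positivity) hsum
    · intro q hq hrq
      exact htail q hq hrq (Δ' + (q.1 : ℝ)) ⟨by linarith [hΔ'.1], by linarith [hΔ'.2]⟩
  intro Δ hΔ
  by_cases hr : IsRegularPoint3D Δ ℓ
  · exact hreg Δ ⟨hΔ.1, hΔ.2.le⟩ hr
  · refine blockPositive_of_eventually_right w z zb hz hzb s Δ ℓ hr ?_
    filter_upwards [eventually_isRegularPoint3D_nhdsGT_of_bound_le (hbd.trans hΔ.1),
      Ioo_mem_nhdsGT hΔ.2] with Δ' hΔ'reg hΔ'
    exact ⟨hΔ'reg, hreg Δ' ⟨hΔ.1.trans hΔ'.1.le, hΔ'.2.le⟩ hΔ'reg⟩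

/-- **Node-level head cell with `s`-pieces, on a box.** The `s`-range `[s_lo, s_hi]` cut into
pieces `σ_0 = s_lo ≤ σ_1 ≤ … ≤ σ_P = s_hi`; the box `Q ⊆ [s_lo, s_hi] × …`; a global tail on the twist
domain (`tail_nonneg_of_pointRules_twist`) with `E₀ ≤ a + n_F + 1`, `ℓ + τ ≤ a`; and per piece the
minorant non-negative on `[0,1] × [a, b]` above the unitarity bound (what a Taylor-model kernel
certifies). CONCLUSION: `φ_p` is block-positive on `[a, b)` for every `p ∈ Q` — the cell hypothesis
of `boxExcluded_of_pointCells`. [cite: HogervorstRychkov2013, §3 eq. (3.9)] -/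
theorem cell_of_headG_pieces {N : ℕ} (w z zb : Fin N → ℝ)
    (hz : ∀ k, z k ∈ Ioo (0 : ℝ) 1) (hzb : ∀ k, zb k ∈ Ioo (0 : ℝ) 1)
    {Q : Set (ℝ × ℝ)} {slo shi E₀ τ : ℝ} (hQ : ∀ p ∈ Q, slo ≤ p.1 ∧ p.1 ≤ shi)
    (htail : ∀ (j : ℕ) (E : ℝ), E₀ ≤ E → (j : ℝ) + τ ≤ E → (j : ℝ) ≤ E → ∀ p ∈ Q,
      0 ≤ pointFunctional w z zb (crossF p.1 (-1) (zMono E j)))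
    {ℓ : ℕ} {a b : ℝ} (nF : ℕ) (hnF : E₀ ≤ a + ((nF : ℝ) + 1))
    (hbd : unitarityBound3D ℓ ≤ a) (haτ : (ℓ : ℝ) + τ ≤ a)
    (σ : ℕ → ℝ) (P : ℕ) (hP : 0 < P) (hσ0 : σ 0 = slo) (hσP : σ P = shi)
    (hσ : ∀ i < P, σ i ≤ σ (i + 1))
    (hpos : ∀ i < P, ∀ Δ ∈ Icc a b, unitarityBound3D ℓ < Δ → ∀ θ ∈ Icc (0 : ℝ) 1,
      0 ≤ headG w z zb ℓ nF (σ i) (σ (i + 1) - σ i) 0 Δ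
        + θ * headG w z zb ℓ nF (σ i) (σ (i + 1) - σ i) 1 Δ
        + θ ^ 2 * headG w z zb ℓ nF (σ i) (σ (i + 1) - σ i) 2 Δ) :
    ∀ p ∈ Q, ∀ Δ ∈ Ico a b, BlockPositive (pointFunctional w z zb) p.1 Δ ℓ := by
  intro p hp Δ hΔ
  obtain ⟨i, hi, hsi⟩ := exists_piece_Icc σ P hP p.1
    ⟨by rw [hσ0]; exact (hQ p hp).1, by rw [hσP]; exact (hQ p hp).2⟩
  have hδ : 0 ≤ σ (i + 1) - σ i := sub_nonneg.2 (hσ i hi)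
  have hsi' : p.1 ∈ Icc (σ i) (σ i + (σ (i + 1) - σ i)) := by
    rw [show σ i + (σ (i + 1) - σ i) = σ (i + 1) by ring]; exact hsi
  refine blockPositive_pointFunctional_of_headG_Ico w z zb hz hzb nF hδ hbd hsi' (hpos i hi) ?_ Δ hΔ
  intro q hq hrq E hE
  have hE0 : E₀ ≤ E := by
    have := headSet_off hnF q hq hrq
    linarith [hE.1]
  have hj : (q.2 : ℝ) ≤ (ℓ : ℝ) + q.1 := by exact_mod_cast hrq.2.1
  have hjτ : (q.2 : ℝ) + τ ≤ E := by linarith [hE.1]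
  have hjE : (q.2 : ℝ) ≤ E := by
    linarith [hE.1, natCast_add_half_le_unitarityBound3D ℓ]
  exact htail q.2 E hE0 hjτ hjE p hp

end Literature.MathematicalPhysics.QuantumFieldTheory.ConformalBootstrap3D
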